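import Summits.ABC.IUTFork.LDHGenuinePerImageUnconditionalDegree
import Literature.IUT.LogVolume.GenuineThetaFieldCyclotomicRamification
import HarnessLib

/-!
# The fork at [IUTchIII] Corollary 3.12, L-DH level, READING (P): the ramification-sharpened Step (ii) bound and sufficiency with
# PLACE-DEPENDENT ramification floors, and the `F`-layer roots of unity (`μ_30 ⊆ F`) pushed up to `K` (proof-only)

Record-only PROOF file (D-0012) of the abc-iut cell (branch C certificate seat abc-iut-C-cert-1, gen 6; row «C:ZETA-CUT», part 1 of the sequel to
`LDHGenuinePerImageUnconditionalDegree.lean` p475570). TAKES NO SIDE on [IUTchIII] Cor. 3.12. abc-iut-c312-d1's Step (ii) lower bound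
`ThetaVolumeDatumAt.ndeg_differentDivisor_ge_of_ramified` (p467927) takes ONE ramification floor `m` for all extra places `Sₓ`; a genuine Θ-volume
datum has DIFFERENT forced floors at different primes: `e ≥ l − 1` over `l` (`ζ_l ∈ K = F(E_F[l])`, abc-iut-s2-p4 p469827) and `2 ∣ e` over `3`,
`4 ∣ e` over `5` (`ζ_3, ζ_5 ∈ F ⊆ K`: the `30`-torsion of `E_F` is `F`-rational, [IUTchIV] Thm. 1.10 p. 22 — abc-iut-W-neg-1's
`ThetaVolumeDatumAt.exists_isPrimitiveRoot_F`, p469119). Hence: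

* `ThetaVolumeDatumAt.ndeg_differentDivisor_ge_of_ramified_fun` — [GenEll] Prop. 1.7 (i) + the tower lemma with a floor FUNCTION `m : v ↦ m_v`:
  `log(𝔡^K) ≥ log-diff + (1 − 1/l)·log 𝔣^{∤2l} + (1/d)·Σ_{v∈Sₓ} (1 − 1/m_v)·log N(v)`;
* `ThetaVolumeDatumAt.cor312PerImageOf_of_le_logDiff_logCond_ramified_fun` — the corresponding sufficient half of the (P)-line crux at a datum;
* `ThetaVolumeDatumAt.sub_one_dvd_ramIdx_mul_ramificationIdx'_of_dvd_thirty` — `(p − 1) ∣ e(v | p)·e(w | v)` for `p ∣ 30` prime, `v ∋ p` a place of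
  `F_tpd`, `w` a prime of `𝓞_K` over `v`.

Part 2 (`LDHGenuinePerImageUnconditionalDegreeThirty.lean`) is the closed-form unconditional test at any degree using both layers. HONEST SCOPE. Statements
about the cell's typed objects; nothing asserts that data exist, nothing asserts Cor. 3.12 in general or in print's reading, nothing asserts abc.
proved-as-typed ≠ in print. [cite: Mochizuki2012, IUTchI Def. 3.1 (c) p. 62; IUTchIII Cor. 3.12 p. 173–174; IUTchIV Thm. 1.10 p. 22, Step (ii) p. 24, Step (v)
p. 27–29] [cite: MochizukiGenEll2010, Prop. 1.7 (i) p. 9–10] [cite: SilvermanAEC2009, Cor. III.8.1.1] [cite: Washington1997, Lemma 1.4 and Prop. 2.1]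
[cite: NeukirchANT1999, Ch. II Prop. (6.8)] [claim: Mochizuki2012, status: disputed] for every IUT quotation. PROOF-ONLY: no definitions, no new `Prop`.
-/

noncomputable section

open NumberField IsDedekindDomain Ideal Module

namespace Literature.IUT.LogVolume.Cor22

open Literature.NumberTheory.DiophantineGeometry.GenEll Summit.ABC.IUTFork Literature.IUT.HodgeTheaters
open Literature.NumberTheory.NumberFields

namespace ThetaVolumeDatumAt

variable {P : NFPoint} {l : ℕ} (T : ThetaVolumeDatumAt P l)

/-! ## 1. Step (ii) lower bound with a place-dependent ramification floor -/

/-- **STEP (ii) LOWER BOUND, SHARPENED BY EXTRA RAMIFIED PLACES WITH PLACE-DEPENDENT FLOORS**: for a finite set `Sₓ` of places of `F_tpd`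
disjoint from `𝕍^bad_mod` and a floor `m_v ≥ 1` such that every place of the datum's `K` over `v ∈ Sₓ` has ramification index `≥ m_v` over `v`:
`log(𝔡^K) ≥ log-diff(λ) + (1 − 1/l)·log 𝔣^{∤2l}(λ) + (1/[F_tpd:ℚ])·Σ_{v∈Sₓ} (1 − 1/m_v)·log N(v)` (abc-iut-c312-d1's `ndeg_differentDivisor_ge_of_ramified`
is the constant-floor case). [cite: MochizukiGenEll2010, Prop. 1.7 (i) p. 9–10] [cite: Mochizuki2012, IUTchIV Thm. 1.10 Step (ii) p. 24]
[claim: Mochizuki2012, status: disputed] -/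
theorem ndeg_differentDivisor_ge_of_ramified_fun (hl : 0 < l) (Sx : Finset (HeightOneSpectrum (𝓞 P.F)))
    (hdisj : Disjoint (badPlacesAvoid P {2, l}) Sx) (m : HeightOneSpectrum (𝓞 P.F) → ℕ) (hm : ∀ v ∈ Sx, 0 < m v)
    (hram : letI := T.instFieldF; letI := T.instNumberFieldF; letI := T.instAlgebraF; letI := T.instFieldK
      letI := T.instNumberFieldK; letI := T.instAlgebraK
      letI : Algebra P.F T.K := ((algebraMap T.F T.K).comp (algebraMap P.F T.F)).toAlgebra
      ∀ v ∈ Sx, ∀ w ∈ IsDedekindDomain.primesOverFinset v.asIdeal (𝓞 T.K), m v ≤ ramificationIdx' v.asIdeal w) :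
    (letI := T.instFieldK; letI := T.instNumberFieldK
     P.logDiff + (1 - 1 / (l : ℝ)) * logCondAvoid P {2, l}
        + (P.degree : ℝ)⁻¹ * ∑ v ∈ Sx, (1 - (m v : ℝ)⁻¹) * Real.log (absNorm v.asIdeal : ℝ)
      ≤ ndeg T.K (differentDivisor T.K)) := by
  classical
  letI := T.instFieldF; letI := T.instNumberFieldF; letI := T.instAlgebraF; letI := T.instFieldK
  letI := T.instNumberFieldK; letI := T.instAlgebraK
  letI : Algebra P.F T.K := ((algebraMap T.F T.K).comp (algebraMap P.F T.F)).toAlgebra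
  -- the places of `K` over `Sₓ`
  set Tx : Finset (HeightOneSpectrum (𝓞 T.K)) := Sx.biUnion fun v =>
    (IsDedekindDomain.primesOverFinset v.asIdeal (𝓞 T.K)).preimage HeightOneSpectrum.asIdeal
      (fun _ _ _ _ h => HeightOneSpectrum.ext h) with hTx
  have hmemTx : ∀ w : HeightOneSpectrum (𝓞 T.K), w.under (𝓞 P.F) ∈ Sx → w ∈ Tx := by
    intro w hw
    rw [hTx, Finset.mem_biUnion]
    refine ⟨w.under (𝓞 P.F), hw, ?_⟩
    rw [Finset.mem_preimage, IsDedekindDomain.mem_primesOverFinset_iff (w.under (𝓞 P.F)).ne_bot]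
    exact ⟨w.isPrime, ⟨rfl⟩⟩
  -- [GenEll] Prop. 1.7 (i) with `S = 𝕍^bad ∪ Sₓ`, `T = 𝕍(K)^bad ∪ Tₓ`
  have hT : ∀ w : HeightOneSpectrum (𝓞 T.K), w.under (𝓞 P.F) ∈ badPlacesAvoid P {2, l} ∪ Sx →
      w ∈ badPlacesOver P {2, l} T.K ∪ Tx := by
    intro w hw
    rcases Finset.mem_union.1 hw with h | h
    · exact Finset.mem_union.2 (Or.inl ((mem_badPlacesOver_iff w).mpr h))
    · exact Finset.mem_union.2 (Or.inr (hmemTx w h))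
  have hmain := cond_sub_cond_le_logdisc_sub_logdisc P.F T.K (badPlacesAvoid P {2, l} ∪ Sx)
    (badPlacesOver P {2, l} T.K ∪ Tx) hT
  rw [Finset.sum_union hdisj] at hmain
  -- the two halves of `T`
  have hlog0 : ∀ w : HeightOneSpectrum (𝓞 T.K), 0 ≤ Real.log (absNorm w.asIdeal : ℝ) := fun w => by
    have h1 : (1 : ℝ) ≤ (absNorm w.asIdeal : ℕ) := by
      exact_mod_cast Nat.one_le_iff_ne_zero.mpr (by rw [Ne, Ideal.absNorm_eq_zero_iff]; exact w.ne_bot)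
    exact Real.log_nonneg h1
  have hsplit : ∑ w ∈ badPlacesOver P {2, l} T.K ∪ Tx, Real.log (absNorm w.asIdeal : ℝ) ≤
      ∑ w ∈ badPlacesOver P {2, l} T.K, Real.log (absNorm w.asIdeal : ℝ)
        + ∑ w ∈ Tx, Real.log (absNorm w.asIdeal : ℝ) := by
    rw [← Finset.sum_union_inter]
    have : 0 ≤ ∑ w ∈ badPlacesOver P {2, l} T.K ∩ Tx, Real.log (absNorm w.asIdeal : ℝ) :=
      Finset.sum_nonneg fun w _ => hlog0 w
    linarith
  -- `(1/[K:ℚ])·Σ_{𝕍(K)^bad} log N(w) = log 𝔣^K ≤ (1/l)·log 𝔣^{F_tpd}` (abc-iut-S4)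
  have hbad : (finrank ℚ T.K : ℝ)⁻¹ * ∑ w ∈ badPlacesOver P {2, l} T.K, Real.log (absNorm w.asIdeal : ℝ) ≤
      (l : ℝ)⁻¹ * logCondAvoid P {2, l} :=
    logCondOver_le_div_of_le_ramificationIdx P {2, l} T.K hl T.l_le_ramificationIdx_of_mem_badPlacesAvoid
  -- `Σ_{Tₓ} = Σ_{v∈Sₓ} Σ_{w ∣ v}`
  have hTsum : ∑ w ∈ Tx, Real.log (absNorm w.asIdeal : ℝ) =
      ∑ v ∈ Sx, ∑ w ∈ IsDedekindDomain.primesOverFinset v.asIdeal (𝓞 T.K), Real.log (absNorm w : ℝ) := by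
    rw [hTx, Finset.sum_biUnion]
    · refine Finset.sum_congr rfl fun v _ => ?_
      refine Finset.sum_preimage HeightOneSpectrum.asIdeal _ _
        (fun w : Ideal (𝓞 T.K) => Real.log (absNorm w : ℝ)) ?_
      intro w hw hnot
      exfalso
      rw [IsDedekindDomain.mem_primesOverFinset_iff v.ne_bot] at hw
      exact hnot ⟨⟨w, hw.1, Ideal.ne_bot_of_mem_primesOver v.ne_bot hw⟩, rfl⟩
    · intro v _ v' _ hne
      refine Finset.disjoint_left.mpr fun w hw hw' => hne ?_
      dsimp only at hw hw'
      rw [Finset.mem_preimage, IsDedekindDomain.mem_primesOverFinset_iff v.ne_bot] at hw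
      rw [Finset.mem_preimage, IsDedekindDomain.mem_primesOverFinset_iff v'.ne_bot] at hw'
      exact HeightOneSpectrum.ext (hw.2.over.trans hw'.2.over.symm)
  -- per place: `(1/[K:ℚ])·Σ_{w ∣ v} log N(w) ≤ (1/m_v)·(1/[F_tpd:ℚ])·log N(v)`
  have hx : (finrank ℚ T.K : ℝ)⁻¹ * ∑ w ∈ Tx, Real.log (absNorm w.asIdeal : ℝ) ≤
      (finrank ℚ P.F : ℝ)⁻¹ * ∑ v ∈ Sx, (m v : ℝ)⁻¹ * Real.log (absNorm v.asIdeal : ℝ) := by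
    rw [hTsum, Finset.mul_sum, Finset.mul_sum]
    refine Finset.sum_le_sum fun v hv => ?_
    have h := cond_above_le_cond_div_of_le_ramificationIdx P.F T.K {v} (hm v hv)
      (fun v' hv' w hw => by
        rw [Finset.mem_singleton] at hv'
        rw [hv'] at hw ⊢
        exact hram v hv w hw)
    rw [Finset.sum_singleton, Finset.sum_singleton] at h
    calc (finrank ℚ T.K : ℝ)⁻¹ * ∑ w ∈ IsDedekindDomain.primesOverFinset v.asIdeal (𝓞 T.K), Real.log (absNorm w : ℝ)
        ≤ (m v : ℝ)⁻¹ * ((finrank ℚ P.F : ℝ)⁻¹ * Real.log (absNorm v.asIdeal : ℝ)) := h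
      _ = (finrank ℚ P.F : ℝ)⁻¹ * ((m v : ℝ)⁻¹ * Real.log (absNorm v.asIdeal : ℝ)) := by ring
  -- `Σ (1 − 1/m_v)·log N(v) = Σ log N(v) − Σ (1/m_v)·log N(v)`
  have hsum2 : ∑ v ∈ Sx, (1 - (m v : ℝ)⁻¹) * Real.log (absNorm v.asIdeal : ℝ) =
      ∑ v ∈ Sx, Real.log (absNorm v.asIdeal : ℝ) - ∑ v ∈ Sx, (m v : ℝ)⁻¹ * Real.log (absNorm v.asIdeal : ℝ) := by
    rw [← Finset.sum_sub_distrib]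
    exact Finset.sum_congr rfl fun v _ => by ring
  -- dictionary of the remaining terms
  have hcond : logCondAvoid P {2, l} = (P.degree : ℝ)⁻¹ * ∑ v ∈ badPlacesAvoid P {2, l},
      Real.log (absNorm v.asIdeal : ℝ) := logCondAvoid_eq_sum P {2, l}
  have hdP : P.logDiff = (P.degree : ℝ)⁻¹ * Real.log ((discr P.F).natAbs : ℝ) := NFPoint.logDiff_eq_log_discr P
  have hdK : ndeg T.K (differentDivisor T.K) = (finrank ℚ T.K : ℝ)⁻¹ * Real.log ((discr T.K).natAbs : ℝ) := by
    have h1 := logDiff_eq_ndeg_differentDivisor (extend P T.K)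
    have h2 := NFPoint.logDiff_eq_log_discr (extend P T.K)
    rw [h1] at h2
    exact h2
  have hdeg : (P.degree : ℝ) = (finrank ℚ P.F : ℝ) := rfl
  have hK0 : 0 ≤ (finrank ℚ T.K : ℝ)⁻¹ := inv_nonneg.mpr (Nat.cast_nonneg _)
  have hsplit' := mul_le_mul_of_nonneg_left hsplit hK0
  have hl1 : (l : ℝ)⁻¹ = 1 / (l : ℝ) := (one_div _).symm
  rw [hl1] at hbad
  rw [hsum2, mul_sub, hcond, hdP, hdK, hdeg]
  rw [hdeg] at hcond
  rw [hcond] at hbad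
  linarith [hmain, hsplit', hbad, hx]

/-! ## 2. The sufficient half of the (P)-line crux at a datum, place-dependent floors -/

/-- **THE SHARPENED SUFFICIENT HALF AT A DATUM, PLACE-DEPENDENT FLOORS**: `λ ∈ U_X`, `l ≥ 1`, `d_mod ≤ (l+5)/4`, `Sₓ` a finite set of places of
`F_tpd` disjoint from `𝕍^bad_mod`, floors `m_v ≥ 1` bounding below the ramification of every place of `K` over `v ∈ Sₓ`; if
`((l+1)/24 − 1/(2l))·log q^{∤2l}(λ) ≤ ((l+5)/4 − d_mod)·(log-diff(λ) + (1 − 1/l)·log 𝔣^{∤2l}(λ) + (1/[F_tpd:ℚ])·Σ_{v∈Sₓ} (1 − 1/m_v)·log N(v)) + ((l+5)/4)·log π`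
then [IUTchIII] Cor. 3.12 holds IN READING (P) at `T` (abc-iut-c312-d1's `cor312PerImageOf_of_le_logDiff_logCond_ramified` is the constant-floor case;
same proof, `GenuineContent.cor312PerImageOf_of_le_mul_ndeg` + §1). [cite: Mochizuki2012, IUTchIII Cor. 3.12 p. 173–174]
[cite: Mochizuki2012, IUTchIV Thm. 1.10 Step (ii) p. 24, Step (v) p. 27–29] [claim: Mochizuki2012, status: disputed] -/
theorem cor312PerImageOf_of_le_logDiff_logCond_ramified_fun (hU : P.InU) (hl : 0 < l)
    (hd : (dmod P : ℝ) ≤ ((l : ℝ) + 5) / 4) (Sx : Finset (HeightOneSpectrum (𝓞 P.F)))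
    (hdisj : Disjoint (badPlacesAvoid P {2, l}) Sx) (m : HeightOneSpectrum (𝓞 P.F) → ℕ) (hm : ∀ v ∈ Sx, 0 < m v)
    (hram : letI := T.instFieldF; letI := T.instNumberFieldF; letI := T.instAlgebraF; letI := T.instFieldK
      letI := T.instNumberFieldK; letI := T.instAlgebraK
      letI : Algebra P.F T.K := ((algebraMap T.F T.K).comp (algebraMap P.F T.F)).toAlgebra
      ∀ v ∈ Sx, ∀ w ∈ IsDedekindDomain.primesOverFinset v.asIdeal (𝓞 T.K), m v ≤ ramificationIdx' v.asIdeal w)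
    (h : (((l : ℝ) + 1) / 24 - 1 / (2 * l)) * logQAvoid P {2, l} ≤
      (((l : ℝ) + 5) / 4 - dmod P) * (P.logDiff + (1 - 1 / (l : ℝ)) * logCondAvoid P {2, l}
          + (P.degree : ℝ)⁻¹ * ∑ v ∈ Sx, (1 - (m v : ℝ)⁻¹) * Real.log (absNorm v.asIdeal : ℝ))
        + ThetaVolumeInput.archLogTheta l) :
    T.Cor312PerImageOf := by
  letI := T.instFieldF; letI := T.instNumberFieldF; letI := T.instAlgebraF; letI := T.instFieldK
  letI := T.instNumberFieldK; letI := T.instAlgebraK; letI := T.instFieldFbar; letI := T.instAlgebraFbar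
  letI := T.instAlgebraKFbar; letI := T.instIsElliptic
  haveI := T.isGalois_fieldOfModuli_K
  have hgap := PointDict.gap_eq T hU
  have hXlN : T.I.X.l = l := T.isVolumeInputOf.l_eq
  have hXl : ((T.I.X.l : ℕ) : ℝ) = (l : ℝ) := by exact_mod_cast hXlN
  have hls : ((T.I.X.lstar : ℝ) + 3) / 2 = ((l : ℝ) + 5) / 4 := by
    have h2 : T.I.X.l = 2 * T.I.X.lstar + 1 := T.I.X.l_eq
    have h2R : ((T.I.X.l : ℕ) : ℝ) = 2 * (T.I.X.lstar : ℝ) + 1 := by exact_mod_cast h2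
    rw [hXl] at h2R
    linarith
  have hdm : (Module.finrank ℚ (fieldOfModuli T.E) : ℝ) = (dmod P : ℝ) := by
    exact_mod_cast PointStepV.finrank_fieldOfModuli_eq_dmod T
  -- the sharpened Step (ii) bound at the datum
  have hdiff := T.ndeg_differentDivisor_ge_of_ramified_fun hl Sx hdisj m hm hram
  have hc : 0 ≤ ((l : ℝ) + 5) / 4 - (dmod P : ℝ) := by linarith
  have hmono := mul_le_mul_of_nonneg_left hdiff hc
  show T.I.Cor312PerImageOf
  refine GenuineContent.cor312PerImageOf_of_le_mul_ndeg T.I ?_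
  rw [hXl, hls, hdm]
  have hg : T.gap = (((l : ℝ) + 1) / 24 - 1 / (2 * l)) * FinDivisor.ndeg (fieldOfModuli T.E) T.I.X.qDivisor := by
    show LgpDivisor.ndegLgp T.I.X.thetaPilot - FinDivisor.ndeg _ T.I.X.qPilot = _
    rw [DHData.ndegLgp_thetaPilot_eq, PilotData.qPilot_eq_smul, map_smul, smul_eq_mul, hXl]
    ring
  rw [← hg, hgap]
  show _ ≤ _ + ThetaVolumeInput.archLogTheta T.I.X.l
  rw [hXlN]
  change P.logDiff + (1 - 1 / (l : ℝ)) * logCondAvoid P {2, l}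
      + (P.degree : ℝ)⁻¹ * ∑ v ∈ Sx, (1 - (m v : ℝ)⁻¹) * Real.log (absNorm v.asIdeal : ℝ)
    ≤ ndeg T.K (differentDivisor T.K) at hdiff
  linarith

/-! ## 3. The `F`-layer roots of unity pushed up to `K`: `(p − 1) ∣ e(v | p)·e(w | v)` for `p ∣ 30` -/

/-- **Tower form at the primes of `30`**: for a prime `p ∣ 30`, a place `v ∋ p` of `F_tpd` and a prime `w` of `𝓞_K` over `v`:
`(p − 1) ∣ e(v | p)·e(w | v)` — `ζ_p ∈ F` (abc-iut-W-neg-1's `exists_isPrimitiveRoot_F`: the `30`-torsion of `E_F` is `F`-rational, Weil pairing),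
hence `ζ_p ∈ K`, so `(p − 1) ∣ e(w | p)` (`sub_one_dvd_ramificationIdx_of_isPrimitiveRoot`), and `e(w | p) = e(v | p)·e(w | v)`
(`ThetaData.absRamificationIdx_eq_ramIdx_mul`). So `2 ∣ e(v|3)·e(w|v)` and `4 ∣ e(v|5)·e(w|v)`. [cite: Mochizuki2012, IUTchIV Thm. 1.10 p. 22]
[cite: SilvermanAEC2009, Cor. III.8.1.1] [cite: Washington1997, Lemma 1.4 and Prop. 2.1] [cite: NeukirchANT1999, Ch. II Prop. (6.8)]
[claim: Mochizuki2012, status: disputed] -/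
theorem sub_one_dvd_ramIdx_mul_ramificationIdx'_of_dvd_thirty {p : ℕ} (hp : p.Prime) (hp30 : p ∣ 30)
    (v : HeightOneSpectrum (𝓞 P.F)) (hv : ((p : ℕ) : 𝓞 P.F) ∈ v.asIdeal)
    {w : letI := T.instFieldK; letI := T.instNumberFieldK; Ideal (𝓞 T.K)}
    (hw : letI := T.instFieldF; letI := T.instNumberFieldF; letI := T.instAlgebraF; letI := T.instFieldK
      letI := T.instNumberFieldK; letI := T.instAlgebraK
      letI : Algebra P.F T.K := ((algebraMap T.F T.K).comp (algebraMap P.F T.F)).toAlgebra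
      w ∈ IsDedekindDomain.primesOverFinset v.asIdeal (𝓞 T.K)) :
    letI := T.instFieldF; letI := T.instNumberFieldF; letI := T.instAlgebraF; letI := T.instFieldK
    letI := T.instNumberFieldK; letI := T.instAlgebraK
    letI : Algebra P.F T.K := ((algebraMap T.F T.K).comp (algebraMap P.F T.F)).toAlgebra
    (p - 1) ∣ ramIdx P.F v * ramificationIdx' v.asIdeal w := by
  letI := T.instFieldF; letI := T.instNumberFieldF; letI := T.instAlgebraF; letI := T.instFieldK
  letI := T.instNumberFieldK; letI := T.instAlgebraK; letI := T.instFieldFbar; letI := T.instAlgebraFbar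
  letI := T.instAlgebraKFbar; letI := T.instIsElliptic
  letI : Algebra P.F T.K := ((algebraMap T.F T.K).comp (algebraMap P.F T.F)).toAlgebra
  obtain ⟨ζ, hζ⟩ := T.exists_isPrimitiveRoot_F hp hp30
  have hζK : IsPrimitiveRoot (algebraMap T.F T.K ζ) p := hζ.map_of_injective (algebraMap T.F T.K).injective
  haveI : v.asIdeal.IsMaximal := v.isMaximal
  have hw' := (IsDedekindDomain.mem_primesOverFinset_iff v.ne_bot (𝓞 T.K)).mp hw
  haveI : w.IsPrime := hw'.1
  haveI : w.LiesOver v.asIdeal := hw'.2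
  have hwbot : w ≠ ⊥ := Ideal.ne_bot_of_liesOver_of_ne_bot v.ne_bot w
  set W : HeightOneSpectrum (𝓞 T.K) := ⟨w, hw'.1, hwbot⟩ with hW
  have hunder : W.under (𝓞 P.F) = v :=
    HeightOneSpectrum.ext (Ideal.LiesOver.over (P := w) (p := v.asIdeal)).symm
  have hlw : ((p : ℕ) : 𝓞 T.K) ∈ W.asIdeal := by
    have h := Ideal.mem_comap.mp ((Ideal.LiesOver.over (P := w) (p := v.asIdeal)) ▸ hv :
      ((p : ℕ) : 𝓞 P.F) ∈ w.under (𝓞 P.F))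
    rwa [map_natCast] at h
  have habs := sub_one_dvd_ramificationIdx_of_isPrimitiveRoot hp hζK W hlw
  rw [ThetaData.absRamificationIdx_eq_ramIdx_mul (F := P.F) W, hunder] at habs
  exact habs

end ThetaVolumeDatumAt

end Literature.IUT.LogVolume.Cor22

end
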